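import Literature.MathematicalPhysics.QuantumFieldTheory.Balaban1983to89.B5Hk164Transl

/-!
# Bałaban [B5] p. 29: «we can verify all the properties of H_kB» — the printed sentence, typed verbatim in
# `B5.lean` as `B5.HkPropsPrinted`, HOLDS for the tree's torus operator `H_k` of (1.63)
# (kernel; cell `pub-balaban`, PAPER SUB-CELL B05)

**Source (verbatim; quotations LOCATE the statement — nothing printed is used as a hypothesis).**
[B5] = T. Bałaban, *Propagators and renormalization transformations for lattice gauge theories. I*,
Commun. Math. Phys. **95** (1984) 17–40 [`Balaban1984PropagatorsI`], p. 29 [PDF 13] (render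
`b2b-balaban-ref1/pages/1984-cmp95-propagators-rt-I/…-p013-x2.png`, READ AS IMAGE by this unit):
«Using (1.60), or better (1.63), we can verify all the properties of H_kB: Q_kH_kB = B, R∂*H_kB = 0, H_kB is a
minimum of ½⟨∂A, ∂A⟩ on the hyperplane {A : Q_kA = B, R∂*A = 0}, which means that ⟨∂A′, ∂H_kB⟩ = 0 on the
subspace {A′ : Q_kA′ = 0, R∂*A′ = 0}.»

**The typed statement (tree, `B5.lean`, PAPER SUB-CELL B05 gen 1).**  `B5.HkData` is the bare carrier
`{CfgA, CfgB : Type; Q : CfgA → CfgB; gauge : CfgA → Prop; energy : CfgA → ℝ; H : CfgB → CfgA}` and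
`B5.HkPropsPrinted D := ∀ B, D.Q (D.H B) = B ∧ D.gauge (D.H B) ∧ ∀ A, D.Q A = B → D.gauge A →
D.energy (D.H B) ≤ D.energy A` — the sentence with «hyperplane»/«subspace» rendered as predicates (its «which
means that» clause is not part of the typed `Prop`; it is proved separately below).

**What is proved here (zero `sorry`).**  For EVERY `d`, every `n ≥ 1` (`[NeZero n]`) and every torus
`M : Fin d → ℕ`, the torus data
`hkDataTorus n M := {CfgA := fine vector fields Tor (fine n M) × Fin d → ℂ, CfgB := coarse vector fields
Tor M × Fin d → ℂ, Q := (Q_k ·) (B5Block118.QvOp), gauge := (R∂*· = 0) with R = 1 − PcT, ∂* = (GradOp)ᴴ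
(B5Value126, B5Action121), energy := ½·cEnergy = ½·Re⟨A, ∂*∂A⟩ = ¼Σ_{x,μ,ν}|F_{μν}[A](x)|² (B5Hk164Transl.cEnergy,
the printed «½⟨∂A, ∂A⟩» without the (1.21) weight η^d — immaterial for an inequality), H := (H_k ·) with THE
(1.63) OPERATOR B5Hk163Torus.HkOp}`
satisfies **`hkPropsPrinted_torus : B5.HkPropsPrinted (hkDataTorus n M)`** — BY NAME from the b05 kernel chain:
`B5Hk163Torus.QvOp_HkOp_mulVec` («Q_kH_kB = B»), `B5Hk163RDiv.R_divS_HkOp` («R∂*H_kB = 0», the symbol-level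
(1.63) computation), `B5Hk163RDiv.HkOp_minimum` («H_kB is a minimum …»).  This is the «or better (1.63)» branch of
the sentence, UNCONDITIONALLY; the «(1.60)» branch is the tree's `B5HkProperties.hkPropsPrinted_of_laws` (pv15),
which derives the same typed `Prop` for the abstract data `OpData.hkData O` under the hypothesis `O.Laws` (the
printed operator identities (1.38), (1.55)–(1.60), (1.69) as axioms of an abstract inner-product structure).
Extras: `energy_min_of_Q_eq` — the minimum property holds on the whole affine space `{Q_kA = B}` (the gauge
condition is not needed for the inequality, only for uniqueness); **`hk_unique`** — on the printed hyperplane the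
minimiser is unique (`B5Hk163RDiv.HkOp_minimum_unique`); `which_means` — the clause «⟨∂A′, ∂H_kB⟩ = 0 on the
subspace {A′ : Q_kA′ = 0, R∂*A′ = 0}» (indeed on all of `{Q_kA′ = 0}`; `B5Hk163RDiv.form_DstarD_HkOp_eq_zero`,
`curl_HkOp_orthogonal`); `gauge_and_Q_iff_mem_Fib` — the data's hyperplane is `B5Hk164Transl.Fib`.
§2 (v1.1, append-only): **THE PRINTED PROPERTIES DETERMINE `H_k`** — `eq_HkOp_of_hkPropsPrinted`: if the torus
data with ANY candidate `H := H′` satisfy `B5.HkPropsPrinted`, then `H′B = H_kB` for every `B`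
(`hkPropsPrinted_iff_eq_HkOp`; `…_scaled` versions for any positive multiple of the energy, e.g. the
(1.21)-weighted «½⟨∂A, ∂A⟩»): an x-space formula such as (1.60), once shown to satisfy the three printed
properties on the torus, is thereby THE (1.63) operator — p. 28 «This defines the operator H_kB = A».

HONEST SCOPE.  (i) Torus model `T_η = fine n M`, `U = 1` (the paper's own setting of Sect. 1); `Δ⁻¹` inside
`P` is the lineage's torus pseudo-inverse reading (zero mode projected out), as in every b05 module.  (ii) The
identification of the tree's (1.63) operator with the x-space formula (1.60) is NOT claimed (abstract logic only,
`B5HkProperties`); with (1.103) it IS the tree's `B5Hk163Form166.HkOp_eq_Hk`.  (iii) Value = the typed printed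
statement of `B5.lean` discharged by kernel theorems for the concrete operator (a DAG edge «statement ⇐ lemmas»);
NOT summit progress.

ABSOLUTE-RULE CENSUS: every theorem below is proved outright from the tree modules named above (sorry-free;
axioms `propext`, `Classical.choice`, `Quot.sound` only); no quoted statement is used as a hypothesis.  Unit
`b2b-balaban-b05-g12` (planner, PAPER SUB-CELL B05 gen 12; journal claim HKPROPS-PRINTED).  Version: v1.1 (v1 p189287 252f3c72dee0 + §2 append-only; v1 declarations
byte-identical).
-/

open scoped BigOperators Matrix ComplexConjugate
open Finset Complex

namespace Literature.MathematicalPhysics.QuantumFieldTheory.Balaban1983to89.B5HkPropsTorus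

open Literature.MathematicalPhysics.QuantumFieldTheory.Balaban1983to89
open Literature.MathematicalPhysics.QuantumFieldTheory.Balaban1983to89.B5 (HkData HkPropsPrinted)
open Literature.MathematicalPhysics.QuantumFieldTheory.Balaban1983to89.B5Hk163RDiv (DstarD form_DstarD
  R_divS_HkOp HkOp_minimum HkOp_minimum_unique form_DstarD_HkOp_eq_zero curl_HkOp_orthogonal)
open Literature.MathematicalPhysics.QuantumFieldTheory.Balaban1983to89.B5Hk164Transl (cEnergy Fib mem_Fib_iff
  cEnergy_eq)
open Literature.MathematicalPhysics.QuantumFieldTheory.Balaban1983to89.B5Prop11Plancherel (Tor fine)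
open Literature.MathematicalPhysics.QuantumFieldTheory.Balaban1983to89.B5Action121 (GradOp Fs CurlOp)
open Literature.MathematicalPhysics.QuantumFieldTheory.Balaban1983to89.B5Block118 (QvOp)
open Literature.MathematicalPhysics.QuantumFieldTheory.Balaban1983to89.B5Hk163Torus (HkOp QvOp_HkOp_mulVec)
open Literature.MathematicalPhysics.QuantumFieldTheory.Balaban1983to89.B5Value126 (PcT)

noncomputable section

variable {d : ℕ} (n : ℕ) [NeZero n] (M : Fin d → ℕ) [hM : ∀ μ, NeZero (M μ)]

open Matrix

/-- **the torus data of the p. 29 sentence**: fine / coarse vector fields, `Q_k`, the gauge condition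
`R∂*A = 0`, the energy `½⟨∂A, ∂A⟩` (unweighted: `½·cEnergy`), and `H_k` = THE (1.63) OPERATOR `HkOp`.
[cite: Balaban1984PropagatorsI, p.29 (text after (1.63)); (1.63) p.29; (1.47) p.26] -/
abbrev hkDataTorus : HkData where
  CfgA := Tor (fine n M) × Fin d → ℂ
  CfgB := Tor M × Fin d → ℂ
  Q := fun A => QvOp n M *ᵥ A
  gauge := fun A => (1 - PcT n M (n : ℂ)) *ᵥ ((GradOp (fine n M) (n : ℂ))ᴴ *ᵥ A) = 0
  energy := fun A => (1 / 2 : ℝ) * cEnergy n M A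
  H := fun B => HkOp n M *ᵥ B

/-- unfolding `Q`. [folklore] -/
@[simp] theorem hkDataTorus_Q (A : Tor (fine n M) × Fin d → ℂ) :
    (hkDataTorus n M).Q A = QvOp n M *ᵥ A := rfl

/-- unfolding `gauge`. [folklore] -/
@[simp] theorem hkDataTorus_gauge (A : Tor (fine n M) × Fin d → ℂ) :
    (hkDataTorus n M).gauge A ↔ (1 - PcT n M (n : ℂ)) *ᵥ ((GradOp (fine n M) (n : ℂ))ᴴ *ᵥ A) = 0 :=
  Iff.rfl

/-- unfolding `energy`. [folklore] -/
@[simp] theorem hkDataTorus_energy (A : Tor (fine n M) × Fin d → ℂ) :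
    (hkDataTorus n M).energy A = (1 / 2 : ℝ) * cEnergy n M A := rfl

/-- unfolding `H`. [folklore] -/
@[simp] theorem hkDataTorus_H (B : Tor M × Fin d → ℂ) : (hkDataTorus n M).H B = HkOp n M *ᵥ B := rfl

/-- the energy in curvature form: `energy A = ¼Σ_{x,μ,ν}|F_{μν}[A](x)|²` ((1.21), unweighted).
[cite: Balaban1984PropagatorsI, (1.21) p.21] -/
theorem hkDataTorus_energy_eq (A : Tor (fine n M) × Fin d → ℂ) :
    (hkDataTorus n M).energy A = (1 / 4 : ℝ) * ∑ x, ∑ μ, ∑ ν, ‖Fs (fine n M) (n : ℂ) A μ ν x‖ ^ 2 := by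
  rw [hkDataTorus_energy, cEnergy_eq]
  ring

/-- the data's «hyperplane {A : Q_kA = B, R∂*A = 0}» is the typed hyperplane `B5Hk164Transl.Fib B`.
[cite: Balaban1984PropagatorsI, p.29 (text), (1.47) p.26] -/
theorem gauge_and_Q_iff_mem_Fib (B : Tor M × Fin d → ℂ) (A : Tor (fine n M) × Fin d → ℂ) :
    ((hkDataTorus n M).Q A = B ∧ (hkDataTorus n M).gauge A) ↔ A ∈ Fib n M B :=
  Iff.rfl

/-- **THE PRINTED SENTENCE HOLDS for the tree's (1.63) operator `H_k` on the torus** — the typed verbatim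
statement `B5.HkPropsPrinted` for `hkDataTorus n M`, every `d`, `n ≥ 1`, `M`: «Q_kH_kB = B, R∂*H_kB = 0, H_kB is a
minimum of ½⟨∂A, ∂A⟩ on the hyperplane {A : Q_kA = B, R∂*A = 0}».  By name: `B5Hk163Torus.QvOp_HkOp_mulVec`,
`B5Hk163RDiv.R_divS_HkOp`, `B5Hk163RDiv.HkOp_minimum`.
[cite: Balaban1984PropagatorsI, p.29 «Using (1.60), or better (1.63), we can verify all the properties of
H_kB …» (proof ours, the (1.63) branch)] -/
theorem hkPropsPrinted_torus : HkPropsPrinted (hkDataTorus n M) := by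
  intro B
  refine ⟨QvOp_HkOp_mulVec n M B, R_divS_HkOp n M B, ?_⟩
  intro A hA _
  change (1 / 2 : ℝ) * cEnergy n M (HkOp n M *ᵥ B) ≤ (1 / 2 : ℝ) * cEnergy n M A
  exact mul_le_mul_of_nonneg_left (HkOp_minimum n M B A hA) (by norm_num)

/-- the same for the whole family of tori and scales at once (no constants are involved, so uniformity is
automatic). [cite: Balaban1984PropagatorsI, p.29 (text)] -/
theorem hkPropsPrinted_torus_all :
    ∀ (d n : ℕ) [NeZero n] (M : Fin d → ℕ) [∀ μ, NeZero (M μ)], HkPropsPrinted (hkDataTorus n M) :=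
  fun _ n _ M _ => hkPropsPrinted_torus n M

/-- the minimum property holds on the whole affine space `{A : Q_kA = B}` — the gauge condition `R∂*A = 0` of
the printed hyperplane is not needed for the inequality (it is needed for uniqueness, `hk_unique`).
[cite: Balaban1984PropagatorsI, p.29 (text); proof ours] -/
theorem energy_min_of_Q_eq (B : Tor M × Fin d → ℂ) (A : Tor (fine n M) × Fin d → ℂ)
    (hA : (hkDataTorus n M).Q A = B) :
    (hkDataTorus n M).energy ((hkDataTorus n M).H B) ≤ (hkDataTorus n M).energy A := by
  change (1 / 2 : ℝ) * cEnergy n M (HkOp n M *ᵥ B) ≤ (1 / 2 : ℝ) * cEnergy n M A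
  exact mul_le_mul_of_nonneg_left (HkOp_minimum n M B A hA) (by norm_num)

/-- **UNIQUENESS on the printed hyperplane**: a field of the hyperplane whose energy does not exceed that of
`H_kB` is `H_kB` (`B5Hk163RDiv.HkOp_minimum_unique`: the gauge condition removes the degeneracy `A ↦ A + ∂λ`).
[cite: Balaban1984PropagatorsI, p.29 (text), p.30 «Δ_a is a positive operator»; proof ours] -/
theorem hk_unique (B : Tor M × Fin d → ℂ) (A : Tor (fine n M) × Fin d → ℂ) (hA : (hkDataTorus n M).Q A = B)
    (hg : (hkDataTorus n M).gauge A)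
    (hle : (hkDataTorus n M).energy A ≤ (hkDataTorus n M).energy ((hkDataTorus n M).H B)) :
    A = (hkDataTorus n M).H B := by
  have hle' : cEnergy n M A ≤ cEnergy n M (HkOp n M *ᵥ B) := by
    have h : (1 / 2 : ℝ) * cEnergy n M A ≤ (1 / 2 : ℝ) * cEnergy n M (HkOp n M *ᵥ B) := hle
    linarith
  exact HkOp_minimum_unique n M B A hA hg hle'

/-- hence the minimiser on the printed hyperplane is characterised: `A = H_kB ↔ (Q_kA = B ∧ R∂*A = 0 ∧
energy A ≤ energy (H_kB))`. [cite: Balaban1984PropagatorsI, p.29 (text); proof ours] -/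
theorem eq_H_iff (B : Tor M × Fin d → ℂ) (A : Tor (fine n M) × Fin d → ℂ) :
    A = (hkDataTorus n M).H B ↔
      ((hkDataTorus n M).Q A = B ∧ (hkDataTorus n M).gauge A
        ∧ (hkDataTorus n M).energy A ≤ (hkDataTorus n M).energy ((hkDataTorus n M).H B)) := by
  constructor
  · rintro rfl
    exact ⟨QvOp_HkOp_mulVec n M B, R_divS_HkOp n M B, le_rfl⟩
  · rintro ⟨hA, hg, hle⟩
    exact hk_unique n M B A hA hg hle

/-- **«which means that ⟨∂A′, ∂H_kB⟩ = 0 on the subspace {A′ : Q_kA′ = 0, R∂*A′ = 0}»** — for the torus data,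
indeed for every `A′` with `Q_kA′ = 0` (the gauge condition is not needed): `⟨A′, ∂*∂H_kB⟩ = 0` and, in curl form,
`⟨curl A′, curl H_kB⟩ = 0` (`B5Hk163RDiv.form_DstarD_HkOp_eq_zero`, `curl_HkOp_orthogonal`).
[cite: Balaban1984PropagatorsI, p.29 (text)] -/
theorem which_means (B : Tor M × Fin d → ℂ) (A' : Tor (fine n M) × Fin d → ℂ)
    (hA' : (hkDataTorus n M).Q A' = (0 : Tor M × Fin d → ℂ)) :
    star A' ⬝ᵥ (DstarD n M *ᵥ (hkDataTorus n M).H B) = 0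
      ∧ star (CurlOp (fine n M) (n : ℂ) *ᵥ A') ⬝ᵥ (CurlOp (fine n M) (n : ℂ) *ᵥ (hkDataTorus n M).H B) = 0 :=
  ⟨form_DstarD_HkOp_eq_zero n M B A' hA', curl_HkOp_orthogonal n M B A' hA'⟩

/-- the printed sentence with its «which means that» clause and uniqueness, bundled, for the subspace as printed
(`Q_kA′ = 0 ∧ R∂*A′ = 0`). [cite: Balaban1984PropagatorsI, p.29 (text)] -/
theorem hkProps_full (B : Tor M × Fin d → ℂ) :
    (hkDataTorus n M).Q ((hkDataTorus n M).H B) = B ∧ (hkDataTorus n M).gauge ((hkDataTorus n M).H B)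
      ∧ (∀ A, (hkDataTorus n M).Q A = B → (hkDataTorus n M).gauge A →
          (hkDataTorus n M).energy ((hkDataTorus n M).H B) ≤ (hkDataTorus n M).energy A
            ∧ ((hkDataTorus n M).energy A ≤ (hkDataTorus n M).energy ((hkDataTorus n M).H B) →
                A = (hkDataTorus n M).H B))
      ∧ (∀ A', (hkDataTorus n M).Q A' = (0 : Tor M × Fin d → ℂ) → (hkDataTorus n M).gauge A' →
          star A' ⬝ᵥ (DstarD n M *ᵥ (hkDataTorus n M).H B) = 0) := by
  refine ⟨QvOp_HkOp_mulVec n M B, R_divS_HkOp n M B, fun A hA hg => ⟨energy_min_of_Q_eq n M B A hA,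
    fun hle => hk_unique n M B A hA hg hle⟩, fun A' hA' _ => (which_means n M B A' hA').1⟩

/-! ## 2. The printed properties DETERMINE `H_k` (v1.1, append-only)

On the torus the three printed properties characterise `H_kB` uniquely (`hk_unique`).  Consequently ANY
candidate `H′ : CfgB → CfgA` for which the torus data (same `Q_k`, same gauge condition, same energy — or any
positive multiple of it, e.g. the (1.21)-weighted «½⟨∂A, ∂A⟩») satisfies the typed sentence `B5.HkPropsPrinted`
coincides with THE (1.63) operator: `H′B = H_kB` for every `B`.  In particular an x-space formula such as (1.60),
once shown to satisfy the three printed properties on the torus (the content of the abstract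
`B5HkProperties.hkPropsPrinted_of_laws`, pv15), is thereby identified with (1.63) — the paper's «Let us write
this operator in momentum representation» (p. 28) becomes a uniqueness statement rather than a symbol
computation.  [cite: Balaban1984PropagatorsI, p.28 «This defines the operator H_kB = A», p.29 (text)] -/

/-- the sentence is insensitive to a non-negative rescaling of the energy (in particular to the (1.21) weight
`η^d` of the printed «½⟨∂A, ∂A⟩»). [cite: Balaban1984PropagatorsI, p.29 (text), (1.21) p.21; proof ours] -/
theorem hkPropsPrinted_torus_scaled (c : ℝ) (hc : 0 ≤ c) :
    HkPropsPrinted { hkDataTorus n M with energy := fun A => c * cEnergy n M A } := by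
  intro B
  refine ⟨QvOp_HkOp_mulVec n M B, R_divS_HkOp n M B, ?_⟩
  intro A hA _
  change c * cEnergy n M (HkOp n M *ᵥ B) ≤ c * cEnergy n M A
  exact mul_le_mul_of_nonneg_left (HkOp_minimum n M B A hA) hc

/-- **THE PRINTED PROPERTIES DETERMINE `H_k`**: if the torus data with `H := H′` (any candidate) satisfy the
typed sentence `B5.HkPropsPrinted`, then `H′B = H_kB` (THE (1.63) operator) for every `B`.
[cite: Balaban1984PropagatorsI, p.28 «This defines the operator H_kB = A», p.29 (text); proof ours
(`hk_unique`)] -/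
theorem eq_HkOp_of_hkPropsPrinted (H' : (Tor M × Fin d → ℂ) → (Tor (fine n M) × Fin d → ℂ))
    (h : HkPropsPrinted { hkDataTorus n M with H := H' }) (B : Tor M × Fin d → ℂ) :
    H' B = HkOp n M *ᵥ B := by
  obtain ⟨hQ, hg, hmin⟩ := h B
  have hle := hmin (HkOp n M *ᵥ B) (QvOp_HkOp_mulVec n M B) (R_divS_HkOp n M B)
  exact hk_unique n M B (H' B) hQ hg hle

/-- the same with any POSITIVE multiple of the energy (e.g. the (1.21)-weighted one).
[cite: Balaban1984PropagatorsI, p.29 (text); proof ours] -/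
theorem eq_HkOp_of_hkPropsPrinted_scaled (c : ℝ) (hc : 0 < c)
    (H' : (Tor M × Fin d → ℂ) → (Tor (fine n M) × Fin d → ℂ))
    (h : HkPropsPrinted { hkDataTorus n M with energy := fun A => c * cEnergy n M A, H := H' })
    (B : Tor M × Fin d → ℂ) : H' B = HkOp n M *ᵥ B := by
  obtain ⟨hQ, hg, hmin⟩ := h B
  have hle : c * cEnergy n M (H' B) ≤ c * cEnergy n M (HkOp n M *ᵥ B) :=
    hmin (HkOp n M *ᵥ B) (QvOp_HkOp_mulVec n M B) (R_divS_HkOp n M B)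
  exact HkOp_minimum_unique n M B (H' B) hQ hg (le_of_mul_le_mul_left hle hc)

/-- hence, for the torus data, the typed sentence holds for a candidate `H′` IF AND ONLY IF `H′` is (pointwise)
THE (1.63) operator. [cite: Balaban1984PropagatorsI, p.29 (text); proof ours] -/
theorem hkPropsPrinted_iff_eq_HkOp (H' : (Tor M × Fin d → ℂ) → (Tor (fine n M) × Fin d → ℂ)) :
    HkPropsPrinted { hkDataTorus n M with H := H' } ↔ ∀ B, H' B = HkOp n M *ᵥ B := by
  refine ⟨fun h B => eq_HkOp_of_hkPropsPrinted n M H' h B, fun h => ?_⟩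
  obtain rfl : H' = fun B => HkOp n M *ᵥ B := funext h
  exact hkPropsPrinted_torus n M

end

end Literature.MathematicalPhysics.QuantumFieldTheory.Balaban1983to89.B5HkPropsTorus
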